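import Literature.MathematicalPhysics.QuantumLattice.BdGBondHamiltonianTrotterDeterminant
import Literature.MathematicalPhysics.QuantumLattice.BdGNambuMatrixPhaseRotation
import HarnessLib

/-!
# The Fock weight of a zero-mode pair-phase history of a BdG reference is a determinant of the jumps

Topic `Literature/MathematicalPhysics/QuantumLattice` (family `hubbard`), joining
`BdGBondHamiltonianTrotterDeterminant` (Fock trace of a Trotter product of BdG Gibbs factors = a
Nambu determinant) and `BdGNambuMatrixPhaseRotation` (a global phase of the pairing data is the
gauge rotation `nambuPhase`; only the jumps survive cyclic telescoping). For ANY finite orbital set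
`Λ`, hopping `τ`, pairing `Δ`, chemical potential `μ`, step `a` and a closed history of GLOBAL
(slice-constant, zero spatial mode) pair phases `θ_t`, `t : Fin (m+1)` (cyclic `t + 1`):

* **`trace_prod_gibbsWeight_bdgBondHamiltonian_phase`** —
  `Tr ∏_t e^{-a H_BdG(τ, e^{iθ_t}Δ, μ)} = e^{-a(m+1)Σ_x(τ(x,x) - μ)} · det(1 + ∏_t e^{-a𝓗(τ,Δ,μ)} u_{θ_{t+1} - θ_t})`,
  `𝓗 = bdgNambuMatrix τ Δ μ`, `u = nambuPhase`: the fermionic weight of the history depends on the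
  phases only through the JUMPS between consecutive slices, as a `2|Λ| × 2|Λ|` determinant — the
  object whose mode factorisation and temporal coercivity are proved downstream for the torus
  (`Summits/…/Theorems/BalabanIRBirGappedPhaseReduction{TorusModes,TemporalModes}`).

No definition; `Theses`-free. [folklore]
-/

noncomputable section

namespace Literature.MathematicalPhysics.QuantumLattice

open Matrix Finset NormedSpace

variable {Λ : Type*} [LinearOrder Λ] [Fintype Λ]

/-- **Fock weight of a zero-mode phase history = determinant of the jumps.** For a closed history of
global pair phases `θ : Fin (m+1) → ℝ`,
`Tr ∏_t e^{-aH_BdG(τ, e^{iθ_t}Δ, μ)} = e^{-a Σ_t Σ_x (τ(x,x) - μ)} · det(1 + ∏_t e^{-a𝓗(τ,Δ,μ)} u_{θ_{t+1}-θ_t})`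
(`t + 1` cyclic). Bach–Lieb–Solovej 1994 §2 (particle–hole/Nambu form); de Gennes (1966) Ch. 5
(gauge covariance); Dereziński–Gérard §17.2.4 (`Tr Γ(γ) = det(1+γ)`).
[cite: DerezinskiGerard2022, §17.2.4] -/
theorem trace_prod_gibbsWeight_bdgBondHamiltonian_phase {m : ℕ} (τ Δ : Λ → Λ → ℂ) (μ a : ℝ)
    (θ : Fin (m + 1) → ℝ) :
    ((List.ofFn fun t => Matrix.gibbsWeight a
        (bdgBondHamiltonian τ (fun x y => Complex.exp (Complex.I * θ t) * Δ x y) μ)).prod).trace =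
      Complex.exp (-(a : ℂ) * ∑ _t : Fin (m + 1), ∑ x, (τ x x - μ)) *
        (1 + (List.ofFn fun t => Matrix.gibbsWeight a (bdgNambuMatrix τ Δ μ) *
          nambuPhase (θ (t + 1) - θ t)).prod).det := by
  rw [trace_prod_gibbsWeight_bdgBondHamiltonian (fun _ => τ)
      (fun t x y => Complex.exp (Complex.I * θ t) * Δ x y) μ a,
    det_one_add_prod_gibbsWeight_bdgNambuMatrix_phase]

end Literature.MathematicalPhysics.QuantumLattice
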